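import Summits.ValiantsHypothesis.ValiantsHypothesis.Theses.DivisionGap
import Summits.ValiantsHypothesis.ValiantsHypothesis.Theorems.DivisionGapSquareGridDimersDivisionEasy
import Summits.ValiantsHypothesis.ValiantsHypothesis.Theorems.DivisionGapZeroOneTransferProjClosure
import Summits.ValiantsHypothesis.ValiantsHypothesis.Theorems.DivisionGapZeroOneTransferStubFormulaGridProjection
import Summits.ValiantsHypothesis.ValiantsHypothesis.Theorems.DivisionGapZeroOneTransferSignEliminationReduction
import Summits.ValiantsHypothesis.ValiantsHypothesis.Theorems.DivisionGapZeroOneTransferSignEliminationOfCertificate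
import Literature.Computability.AlgebraicComplexity.ArithCircuitProofs
import Literature.Computability.AlgebraicComplexity.QuasiPolynomialFormulasProofs
import HarnessLib.Audit

/-!
# Line `planar-dimer-sign-elimination` — skeleton for crux `DivisionGap.ZeroOneTransfer`
(item stmt-ValiantsHypothesis-5066, route route-ValiantsHypothesis-DivisionGap)

Idea (card `Cruxes/ZeroOneTransfer/Ideas/planar-dimer-sign-elimination.md`, triage r1-1/2/3: pass ×3):
collapse the crux's universal quantifier over `VP_ℂ` circuits onto ONE combinatorial family — perfect
matchings (dimers) of the `N × N` square grid written with doubled edge variables `X (v, f v)`, token for token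
the polynomial of the route's items `SquareGridDimersDivisionEasy` (5072) / `TriangularDimersDivisionEasy` (5067);
spanning subgraphs, edge weights and constants are Valiant projections of it (`IsProjection`: variables ↦
variables or constants of the coefficient semiring — `ℂ` on the signed side, `ℝ≥0` on the monotone side).
Below `PM_R(N)` abbreviates that inline polynomial over `R` (`PM_R(0) = 1`, `PM_R(1) = 0`, `PM_R(2)` = the two
matchings of the square, so single variables and constants are projections of `PM_R(2)`), and
`Q_c(n) := 2^((log₂ n + c)^c)`.

Chain (four registered stubs, composed by `ZeroOneTransfer_of`, sorry-free):

* (U) `stub_formulaGridProjection` — SIGNED universality, over EVERY commutative semiring `R`: a polynomial of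
  formula size `s` is a Valiant projection of `PM_R(N)`, `N ≤ s^c + c` (formula ⇒ series-parallel, hence PLANAR,
  branching program ⇒ planar bipartite perfect matchings by vertex splitting (Datta–Kulkarni–Limaye–Mahajan 2010
  §4.4) ⇒ grid layout).  With the tree's PROVED `VP ⊆ VQP` (`IsVPFamily.isVQPFamily`) and `VQP_e = VQP`
  (`BCS1997_thm_21_33_holds`, BCS (21.33)/(21.36)) this makes every complexified 0/1 `VP_ℂ` family a
  `Q_c(n)`-projection of `PM_ℂ(N)` with complex constants (the formula's, negative ones included) on the edges of
  a planar bipartite graph — the "signed planar dimer" normal form of the card.  At quasi-polynomial scale DKLM's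
  weight-`(-1)` crossing gadget (their Thm 1(3), §4.1) is not even needed: formulas are already planar; it stays
  the polynomial-size statement and the source of the sign-gauge / vortex picture.
* (S) `stub_signElimination` — THE BET (hardest stub): a `0/1`-coefficient family over `ℝ≥0` whose
  complexification is a `Q_c(n)`-projection of `PM_ℂ` is a RATIO OF TWO SHORT SUMS of MONOTONE grid-dimer
  projections: `f_n · Σ_{i<I} m_i = Σ_{j<J} g_j`, `Σ_i m_i ≠ 0`, all `m_i, g_j` projections over `ℝ≥0` of
  `PM_{ℝ≥0}(N)`, `N, I, J ≤ Q_c(n)` (multiplier + short sums: triage r1-2 sharpening).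
* (G) `stub_squareGridDimersDivisionEasy` — the route's support item 5072 BY NAME: `PM_{ℝ≥0}(N)` is division-easy
  (Propp 2003 urban renewal / Kuo 2004 condensation, subtraction-free).
* (F1) `stub_projectionClosure` — over `ℝ≥0`, division complexity does not grow under Valiant projections, zero
  substitutions INCLUDED (finding F1 of all three triagers: killed variables ↦ one fresh `t`, bottom `t`-forms are
  free by the gate pruning of the landed `Negative/TopComponentFree.lean`, then `t ↦ 1`).

Glue: `VP ⊆ VQF` (tree) + (U) at `R = ℂ` + `absorb₁` give the hypothesis of (S); (S) gives `f_n · M = G`,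
`M = Σ m_i`, `G = Σ g_j`; (G) gives ONE cofactor `h` of `PM_{ℝ≥0}(N)`; (F1) transports it to cofactors `hm_i`,
`hg_j` within the budget `s = N^d + d`; the cofactor of `f_n` is `H := M · Π_i hm_i · Π_j hg_j ≠ 0`, with
`f_n · H = (G · Π_j hg_j) · Π_i hm_i` and `(Σ_i u_i) · Π_i h_i = Σ_i (u_i h_i) · Π_{k≠i} h_k` (`sum_prod_bound`,
`quotient_bound`: bookkeeping with `complexity_add_le` / `complexity_mul_le`); `arith` bounds the total by
`16 (d+1) Q^{d+2}` and `absorb₂` folds that into one quasi-polynomial exponent `C = c + 2d + 6`.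

STRENGTH OF (S) — read before attacking it.  The OUTPUT form of (S) is not an extra constraint: by the tree's
depth reduction over commutative semirings (`formulaComplexity_le_two_pow`, stated for `CommSemiring k`, hence for
`ℝ≥0`) a division certificate `f·h = g` with `L₊(g), L₊(h), deg g` quasi-polynomial yields quasi-polynomial
MONOTONE formulas for `g` and `h`, and (U) at `R = ℝ≥0` turns those into monotone projections of `PM_{ℝ≥0}(N)`
(`I = J = 1`).  So modulo (U), (G), (F1): (S) ⟺ "every 0/1 family with a quasi-polynomial signed grid-dimer
representation has quasi-polynomial division complexity (with a quasi-polynomial-degree cofactor)" — the crux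
transported to the dimer world, slightly STRONGER (its hypothesis is `VQP`-type, not `VP`), never weaker.  What
the line adds is the INPUT normal form: H2 becomes "remove the negative/complex edge constants of ONE explicit
planar bipartite family when the global output is 0/1", with Pfaffian-orientation / matchgate / urban-renewal
tools attached.  Consequence for the triage test (r1-1, r1-3: "is `ST_N` of the complete digraph in the planar
dimer span?"): YES — FGK14 Thm 7.2 (star–mesh) gives `ST_N · Π pivots = G` with polynomial monotone circuits of
polynomial degree, hence (depth reduction + (U) over `ℝ≥0`) the (S)-form with `I = J = 1`; that test is settled
and no longer discriminates.  The decisive instance remains `f = D_n` (crux 5067, `VP` by Kasteleyn).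

Disproof.lean (cdisprove) obligations honoured: `zeroOneTransfer_false_without_VP` — `IsVPFamily` is consumed in
the glue (`IsVPFamily.isVQPFamily`, `BCS1997_thm_21_33_holds`) to produce the hypothesis of (S); no `VP` ⇒ no
quasi-polynomial formula ⇒ no grid representation.  `not_zeroOneTransferNoDivision` — division enters at
`stub_squareGridDimersDivisionEasy` (urban-renewal cell factors) and through the denominator `Σ_i m_i` of (S)
(with `I = 1, m_0 = 1, J = 1` (S) would make every 0/1 `VP` family a monotone projection of planar dimers, i.e.
give it quasi-polynomial MONOTONE-with-one-planar-PM-oracle structure; for `ST_N` that is exactly what star–mesh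
does NOT give without the pivots).  Consistent with the landed `Negative/LowDegreeCofactor.lean` (cofactors of
degree comparable to `deg f` are necessary: Propp's `h` is a product of `Θ(#cells)` cell factors).  Kill
criterion (C) `zeroOneTransfer_false_of_triangularDimers_hard` is SHARED — Kasteleyn puts the triangular family
`D_n` of crux 5067 in `VP_ℂ`, so the four stubs restricted to `f = D_n` prove `TriangularDimersDivisionEasy`, and
`¬ TriangularDimersDivisionEasy` kills `stub_signElimination` together with the crux (no wasted staffing).  Landed
`Negative/{FalseWithoutVP, NoDivisionFalse, TopComponentFree, KillRows, LowDegreeCofactor,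
FalseOfTriangularDimersHard}`: no stub is an instance they refute ((G), (S) are UPPER bounds with division;
`NoDivisionFalse` refutes only the cofactor-free strengthening, for `ST`).  Negatives index (UlrichPadded, Elusive,
GrenetRigidity ×2): unrelated.

LEAD c7 RESHAPE (2026-08-16T17:1xZ, prover-line-stmt-ValiantsHypothesis-5066-c7-0): stubs (G) and (F1) are now TREE
THEOREMS and are discharged by them — `stub_squareGridDimersDivisionEasy := squareGridDimersDivisionEasy_proof` (item
5072, Theorems/DivisionGapSquareGridDimersDivisionEasy.lean) and `stub_projectionClosure` (universe `Type`, as the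
composition uses it) `:= DivisionGapZeroOneTransfer.stub_projClosure` (p89287).  Open stubs after wave 1: ONLY the bet (S) `stub_signElimination` — (U) `stub_formulaGridProjection` LANDED (worker,
p122796 + Aux1–9) and is discharged below; two reductions `signEliminationReduction` ((S) ⟹ crux) and
`signElimination_of_degCertificate` (crux_deg on (S)'s class ⟹ (S)) are tree theorems p123350 / p123433 (see their section).

`lean check`: rc 0, ONE sorry = the bet `stub_signElimination`; `ZeroOneTransfer_of` concludes the crux BY NAME.  Stub
signatures use only importable declarations (`Literature.Computability.AlgebraicComplexity.{complexity,
formulaComplexity, IsProjection}`, the route decl `SquareGridDimersDivisionEasy`, Mathlib), so each can be landed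
verbatim as `Theorems/DivisionGapZeroOneTransfer<Stub>.lean --supports stmt-ValiantsHypothesis-5066`
(stub (G) rather as `--workitem stmt-ValiantsHypothesis-5072`).
-/

open MvPolynomial Finset
open scoped BigOperators
open Literature.Computability.AlgebraicComplexity
open Summit.ValiantsHypothesis.ValiantsHypothesis.Theses.DivisionGap

set_option linter.dupNamespace false

namespace Summit.ValiantsHypothesis.ValiantsHypothesis.Cruxes.ZeroOneTransfer.PlanarDimerSignElimination

/-! ## Stubs -/

/-- **Stub 1 (U) — formulas are projections of grid dimers, over every commutative semiring (L-sized; TRUE,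
classical, sign-agnostic).**  There is `c` such that for every commutative semiring `R`, variable type `ι` and
`g ∈ R[ι]` of fan-in-two formula size `s = formulaComplexity g` (the tree's `E(g)`, `CircuitDepth.lean`), `g` is
a Valiant projection (entries ↦ variables of `g` or constants of `R`) of `PM_R(N)` for some `N ≤ s^c + c`.
Construction: formula ⇒ series-parallel branching program with edge labels in `{X i} ∪ R` (leaf = one edge;
weighted sum gate `a•u + b•v` = parallel composition behind two constant edges `a`, `b`; product = series), size
`O(s)`, PLANAR because series-parallel; planar DAG `s`–`t` path polynomial ⇒ perfect matchings of a planar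
BIPARTITE graph by vertex splitting (`v ↦ v_in — v_out` of weight `1`, arc `u → v ↦ u_out — v_in`; matchings ↔
`s`–`t` paths since a DAG has no cycles; DattaKulkarniLimayeMahajan2010 §4.4), degree ≤ 3; ⇒ spanning subgraph of
the `N × N` grid, `N = poly(s)`: orthogonal grid drawing (Valiant 1981 / Tamassia), the two colour classes on cells
of the two parities so that every routed edge is an odd lattice path (matching-preserving subdivision; the edge's
label on its first segment, `1` on the others), the drawing assembled from constant-size tiles whose unused cells
carry a fixed weight-`1` domino tiling, absent grid edges ↦ `0`.  `s = 0` (a variable or a constant) ↦ `N = 2`.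
No planarity THEORY is needed (the target is an explicit layout), but the tiling bookkeeping makes this L/XL as a
formalisation; worth vendoring as a Literature fact `FormulaGridDimerProjection`.  Used at `R = ℂ` in the glue;
at `R = ℝ≥0` it is the converse tool showing that the output form of Stub 2 is no extra constraint (header,
"STRENGTH OF (S)").
[cite: DattaKulkarniLimayeMahajan2010, §4.4] [cite: Valiant1981] [cite: Burgisser2000, §2.1] -/
theorem stub_formulaGridProjection :
    ∃ c : ℕ, ∀ (R : Type) [CommSemiring R] (ι : Type) (g : MvPolynomial ι R),
      ∃ N : ℕ, N ≤ (formulaComplexity g) ^ c + c ∧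
        IsProjection g
          (∑ f ∈ (Finset.univ : Finset (Fin N × Fin N → Fin N × Fin N)).filter (fun f => ∀ v, f (f v) = v ∧ f v ≠ v ∧ (((v.1 : ℕ) + 1 = (f v).1 ∧ (v.2 : ℕ) = (f v).2) ∨ (((f v).1 : ℕ) + 1 = v.1 ∧ (v.2 : ℕ) = (f v).2) ∨ ((v.1 : ℕ) = (f v).1 ∧ (v.2 : ℕ) + 1 = (f v).2) ∨ ((v.1 : ℕ) = (f v).1 ∧ ((f v).2 : ℕ) + 1 = v.2))), ∏ v : Fin N × Fin N, (MvPolynomial.X (v, f v) : MvPolynomial ((Fin N × Fin N) × (Fin N × Fin N)) R)) :=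
  ⟨8, fun R _ ι g =>
    Summit.ValiantsHypothesis.ValiantsHypothesis.Theorems.DivisionGapZeroOneTransfer.FormulaGridProjection.formulaGridProjection
      R ι g⟩

/-- **Stub 2 (S) — SIGN ELIMINATION for 0/1 outputs (THE BET; hardest stub; open, crux-strength — see the header
remark "STRENGTH OF (S)").**  If `f_n ∈ ℝ≥0[σ n]` has coefficients in `{0,1}` and its complexification is a Valiant
projection over `ℂ` (arbitrary complex constants: the formula's constants, negative ones included) of `PM_ℂ(N)`,
`N ≤ 2^((log₂ n + c)^c)` — which the glue derives from `IsVPFamily` by `VP ⊆ VQF` (tree) and Stub 1 — then `f_n` is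
a RATIO OF TWO SHORT SUMS of MONOTONE grid-dimer projections: for some `c'` and all `n` there are
`N, I, J ≤ 2^((log₂ n + c')^c')` and projections OVER `ℝ≥0` (constants `≥ 0`; `0` cuts out spanning subgraphs)
`m_i` (`i < I`), `g_j` (`j < J`) of `PM_{ℝ≥0}(N)` with `Σ_i m_i ≠ 0` and `f_n · Σ_i m_i = Σ_j g_j`.  All of H2's
difficulty along this line sits here, for ONE family: the signs live on edges of a planar bipartite graph and are
classified, modulo vertex gauge, by their face monodromies ("vortices" = faces of monodromy `-1`); vortex number is
conserved under genus-0 double covers (card: `C₄ → C₈`) and no LOCAL un-signing gadget exists (it would exhibit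
`det_m` as a monotone projection of unsigned dimers), so a proof must consume the 0/1-ness of the GLOBAL output —
tools: Pfaffian orientations / Pólya's problem (Kasteleyn; Little 1975; Robertson–Seymour–Thomas 1999; McCuaig 2004),
matchgate identities and holographic basis changes (Valiant 2008; Cai–Lu 2011), urban renewal / Kuo condensation as
the native division engine, Soittola's theorem as the one-variable model (nonnegative rational series are positive
under a dominant-root condition — sign elimination can FAIL without 0/1-type hypotheses).  Why it might fail: it is
(slightly stronger than) the crux — an explicit 0/1 family with a quasi-polynomial signed grid representation and
super-quasi-polynomial division complexity kills it; first suspect = the decisive instance `f = D_n`, the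
triangular-lattice dimers of crux 5067 (`VP_ℂ` by Kasteleyn; (S) there ⇒ `TriangularDimersDivisionEasy`; cdisprove's
Kuo probe j008644: every genuine 4-point condensation on `T_4, T_6` subtracts).  The `ST_N` test of triage r1-1/r1-3
is already PASSED (`I = J = 1`, header).  Division is load-bearing through `Σ_i m_i` (Disproof (B):
`not_zeroOneTransferNoDivision`).
[cite: FominGrigorievKoshevoy2014, Remark 1.5] [cite: RobertsonSeymourThomas1999] [cite: Valiant2008] [cite: Kuo2004, Thm 2.1, 2.3, 5.1] [cite: DattaKulkarniLimayeMahajan2010, §5.3] -/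
theorem stub_signElimination :
    ∀ (σ : ℕ → Type) [∀ n, Fintype (σ n)] (f : ∀ n, MvPolynomial (σ n) NNReal),
      (∀ n m, MvPolynomial.coeff m (f n) = 0 ∨ MvPolynomial.coeff m (f n) = 1) →
      (∃ c : ℕ, ∀ n : ℕ, ∃ N : ℕ, N ≤ 2 ^ ((Nat.log 2 n + c) ^ c) ∧
        IsProjection (MvPolynomial.map (Complex.ofRealHom.comp NNReal.toRealHom) (f n))
          (∑ f ∈ (Finset.univ : Finset (Fin N × Fin N → Fin N × Fin N)).filter (fun f => ∀ v, f (f v) = v ∧ f v ≠ v ∧ (((v.1 : ℕ) + 1 = (f v).1 ∧ (v.2 : ℕ) = (f v).2) ∨ (((f v).1 : ℕ) + 1 = v.1 ∧ (v.2 : ℕ) = (f v).2) ∨ ((v.1 : ℕ) = (f v).1 ∧ (v.2 : ℕ) + 1 = (f v).2) ∨ ((v.1 : ℕ) = (f v).1 ∧ ((f v).2 : ℕ) + 1 = v.2))), ∏ v : Fin N × Fin N, (MvPolynomial.X (v, f v) : MvPolynomial ((Fin N × Fin N) × (Fin N × Fin N)) ℂ))) →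
      ∃ c : ℕ, ∀ n : ℕ, ∃ N I J : ℕ, N ≤ 2 ^ ((Nat.log 2 n + c) ^ c) ∧ I ≤ 2 ^ ((Nat.log 2 n + c) ^ c) ∧
        J ≤ 2 ^ ((Nat.log 2 n + c) ^ c) ∧
        ∃ (m : Fin I → MvPolynomial (σ n) NNReal) (g : Fin J → MvPolynomial (σ n) NNReal),
          (∀ i, IsProjection (m i)
            (∑ f ∈ (Finset.univ : Finset (Fin N × Fin N → Fin N × Fin N)).filter (fun f => ∀ v, f (f v) = v ∧ f v ≠ v ∧ (((v.1 : ℕ) + 1 = (f v).1 ∧ (v.2 : ℕ) = (f v).2) ∨ (((f v).1 : ℕ) + 1 = v.1 ∧ (v.2 : ℕ) = (f v).2) ∨ ((v.1 : ℕ) = (f v).1 ∧ (v.2 : ℕ) + 1 = (f v).2) ∨ ((v.1 : ℕ) = (f v).1 ∧ ((f v).2 : ℕ) + 1 = v.2))), ∏ v : Fin N × Fin N, (MvPolynomial.X (v, f v) : MvPolynomial ((Fin N × Fin N) × (Fin N × Fin N)) NNReal))) ∧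
          (∀ j, IsProjection (g j)
            (∑ f ∈ (Finset.univ : Finset (Fin N × Fin N → Fin N × Fin N)).filter (fun f => ∀ v, f (f v) = v ∧ f v ≠ v ∧ (((v.1 : ℕ) + 1 = (f v).1 ∧ (v.2 : ℕ) = (f v).2) ∨ (((f v).1 : ℕ) + 1 = v.1 ∧ (v.2 : ℕ) = (f v).2) ∨ ((v.1 : ℕ) = (f v).1 ∧ (v.2 : ℕ) + 1 = (f v).2) ∨ ((v.1 : ℕ) = (f v).1 ∧ ((f v).2 : ℕ) + 1 = v.2))), ∏ v : Fin N × Fin N, (MvPolynomial.X (v, f v) : MvPolynomial ((Fin N × Fin N) × (Fin N × Fin N)) NNReal))) ∧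
          (∑ i, m i) ≠ 0 ∧ f n * ∑ i, m i = ∑ j, g j := by
  sorry

/-- **Stub 3 (G) — square-grid dimers are division-easy = route support item `SquareGridDimersDivisionEasy`
(stmt-ValiantsHypothesis-5072) BY NAME (M-sized, believed routine).**  `∃ c ∀ N ∃ h ≠ 0, L₊(PM_{ℝ≥0}(N)·h) +
L₊(h) ≤ N^c + c`.  Proof route: Propp's urban renewal on an Aztec diamond `AD_m ⊇` the `N × N` grid with FULL
symbolic weights is an `O(m³)`-step `{+,×,÷}` computation whose denominators (cell factors `wz + xy`) are nonzero
polynomials (Propp2003 §2, §5; Kuo2004 Thm 5.1 `W(G)W(G−abcd) = W(G−ab)W(G−cd) + W(G−ad)W(G−bc)`), i.e. a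
Hrubeš–Yehudayoff normal form `PM(AD_m)·h = g` with monotone `g, h` (numerator/denominator tracking gate by gate);
the grid is cut out of `AD_m` by the ZERO substitution of Stub 4 applied with the complement frozen on a fixed
weight-`1` matching (triage F1 — the `0/0` caveat recorded on item 5072 disappears).  Land it as
`--workitem stmt-ValiantsHypothesis-5072`. [cite: Propp2003, §2 and §5] [cite: Kuo2004, Thm 5.1] -/
theorem stub_squareGridDimersDivisionEasy : SquareGridDimersDivisionEasy :=
  Summit.ValiantsHypothesis.ValiantsHypothesis.Theorems.squareGridDimersDivisionEasy_proof

/-- **Stub 4 (F1) — monotone projections are free for division complexity, zero substitutions included (M-sized,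
proof known).**  Over `ℝ≥0`: if `q` is a Valiant projection of `p` (variables ↦ variables or constants `≥ 0`,
possibly `0`) and `h ≠ 0`, then some `h' ≠ 0` has `L₊(q·h') + L₊(h') ≤ L₊(p·h) + L₊(h)`.  Proof (triage r1-1 F1 =
r1-3 F1 = r1-2 salvage): send the variables killed by the projection to ONE fresh variable `t` and the others to
their targets — nonzero constants and identifications keep `h ≠ 0` over `ℝ≥0` (evaluate at a positive point);
bottom `t`-forms satisfy `bot(P̃H̃) = bot(P̃)·bot(H̃) ≠ 0` (no cancellation, no zero divisors) and cost nothing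
(gate pruning: a sum gate keeps its operands of minimal `t`-order — the bottom twin of the landed
`Negative/TopComponentFree.lean: complexity_topComponent_le`); `bot(P̃) = q` when `q ≠ 0` (else `h' := 1`);
finally `t ↦ 1` is a projection (`IsProjection.complexity_le_holds`).  Overhead ZERO — no Jukna–Seiwert–Sergeev
reciprocal-input bound needed.  Leans on: `IsProjection.complexity_le_holds`, `complexity_rename_le_holds'`, the
pruning engine of `Negative.TopComponentFree`. [folklore] -/
theorem stub_projectionClosure :
    ∀ {τ ι : Type} (p : MvPolynomial τ NNReal) (q : MvPolynomial ι NNReal),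
      IsProjection q p → ∀ h : MvPolynomial τ NNReal, h ≠ 0 →
        ∃ h' : MvPolynomial ι NNReal, h' ≠ 0 ∧
          complexity (q * h') + complexity h' ≤ complexity (p * h) + complexity h :=
  fun {τ ι} p q hqp h hh =>
    Summit.ValiantsHypothesis.ValiantsHypothesis.Theorems.DivisionGapZeroOneTransfer.stub_projClosure
      τ ι p q hqp h hh


/-! ## Registered reductions (lead c7): the bet is sandwiched by the crux

Both are TREE THEOREMS now (lead c7): `Theorems/DivisionGapZeroOneTransferSignEliminationReduction.lean`
(p123350) and `Theorems/DivisionGapZeroOneTransferSignEliminationOfCertificate.lean` (p123433), imported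
and restated here by name.  With them the bet (S) is sandwiched: `ZeroOneTransfer ⟸ (S) ⟸ (crux + qp
cofactor degree on (S)'s hypothesis class)` — the line is reduced to the crux itself. -/

/-- **Registered reduction 1: (S) ⟹ crux** — the composition `ZeroOneTransfer_of` below with the bet as
an explicit hypothesis (every other stub is a tree theorem). Tree theorem p123350. [folklore] -/
theorem signEliminationReduction
    (hS :
      ∀ (σ : ℕ → Type) [∀ n, Fintype (σ n)] (f : ∀ n, MvPolynomial (σ n) NNReal),
        (∀ n m, MvPolynomial.coeff m (f n) = 0 ∨ MvPolynomial.coeff m (f n) = 1) →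
        (∃ c : ℕ, ∀ n : ℕ, ∃ N : ℕ, N ≤ 2 ^ ((Nat.log 2 n + c) ^ c) ∧
          IsProjection (MvPolynomial.map (Complex.ofRealHom.comp NNReal.toRealHom) (f n))
            (∑ f ∈ (Finset.univ : Finset (Fin N × Fin N → Fin N × Fin N)).filter (fun f => ∀ v, f (f v) = v ∧ f v ≠ v ∧ (((v.1 : ℕ) + 1 = (f v).1 ∧ (v.2 : ℕ) = (f v).2) ∨ (((f v).1 : ℕ) + 1 = v.1 ∧ (v.2 : ℕ) = (f v).2) ∨ ((v.1 : ℕ) = (f v).1 ∧ (v.2 : ℕ) + 1 = (f v).2) ∨ ((v.1 : ℕ) = (f v).1 ∧ ((f v).2 : ℕ) + 1 = v.2))), ∏ v : Fin N × Fin N, (MvPolynomial.X (v, f v) : MvPolynomial ((Fin N × Fin N) × (Fin N × Fin N)) ℂ))) →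
        ∃ c : ℕ, ∀ n : ℕ, ∃ N I J : ℕ, N ≤ 2 ^ ((Nat.log 2 n + c) ^ c) ∧ I ≤ 2 ^ ((Nat.log 2 n + c) ^ c) ∧
          J ≤ 2 ^ ((Nat.log 2 n + c) ^ c) ∧
          ∃ (m : Fin I → MvPolynomial (σ n) NNReal) (g : Fin J → MvPolynomial (σ n) NNReal),
            (∀ i, IsProjection (m i)
              (∑ f ∈ (Finset.univ : Finset (Fin N × Fin N → Fin N × Fin N)).filter (fun f => ∀ v, f (f v) = v ∧ f v ≠ v ∧ (((v.1 : ℕ) + 1 = (f v).1 ∧ (v.2 : ℕ) = (f v).2) ∨ (((f v).1 : ℕ) + 1 = v.1 ∧ (v.2 : ℕ) = (f v).2) ∨ ((v.1 : ℕ) = (f v).1 ∧ (v.2 : ℕ) + 1 = (f v).2) ∨ ((v.1 : ℕ) = (f v).1 ∧ ((f v).2 : ℕ) + 1 = v.2))), ∏ v : Fin N × Fin N, (MvPolynomial.X (v, f v) : MvPolynomial ((Fin N × Fin N) × (Fin N × Fin N)) NNReal))) ∧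
            (∀ j, IsProjection (g j)
              (∑ f ∈ (Finset.univ : Finset (Fin N × Fin N → Fin N × Fin N)).filter (fun f => ∀ v, f (f v) = v ∧ f v ≠ v ∧ (((v.1 : ℕ) + 1 = (f v).1 ∧ (v.2 : ℕ) = (f v).2) ∨ (((f v).1 : ℕ) + 1 = v.1 ∧ (v.2 : ℕ) = (f v).2) ∨ ((v.1 : ℕ) = (f v).1 ∧ (v.2 : ℕ) + 1 = (f v).2) ∨ ((v.1 : ℕ) = (f v).1 ∧ ((f v).2 : ℕ) + 1 = v.2))), ∏ v : Fin N × Fin N, (MvPolynomial.X (v, f v) : MvPolynomial ((Fin N × Fin N) × (Fin N × Fin N)) NNReal))) ∧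
            (∑ i, m i) ≠ 0 ∧ f n * ∑ i, m i = ∑ j, g j) :
    ZeroOneTransfer :=
  Summit.ValiantsHypothesis.ValiantsHypothesis.Theorems.DivisionGapZeroOneTransfer.signEliminationReduction hS

/-- **Registered reduction 2: crux + cofactor-degree clause (on (S)'s hypothesis class) ⟹ (S)** — the
converse normal form: a division certificate `f_n · h = g` of quasi-polynomial size AND degree is ONE
quotient of monotone grid-dimer projections (`gridQuotient_of_certificate`: semiring depth reduction +
(U) at `R = ℝ≥0` with a prescribed common grid size), so (S) holds with `I = J = 1`.  Tree theorem p123433.  Consequence: (S) is the crux in grid-dimer normal form —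
crux-EQUIVALENT up to the route's own open cofactor-degree clause (item 15046) and the `VP → VQP`-type
enlargement of the hypothesis class — exactly the status of S2 (line `arborescence-span`) and
`ForestQuotient` (line `hidden-markov-intertwiner`). [folklore] -/
theorem signElimination_of_degCertificate
    (H : ∀ (σ : ℕ → Type) [∀ n, Fintype (σ n)] (f : ∀ n, MvPolynomial (σ n) NNReal),
      (∀ n m, MvPolynomial.coeff m (f n) = 0 ∨ MvPolynomial.coeff m (f n) = 1) →
      (∃ c : ℕ, ∀ n : ℕ, ∃ N : ℕ, N ≤ 2 ^ ((Nat.log 2 n + c) ^ c) ∧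
        IsProjection (MvPolynomial.map (Complex.ofRealHom.comp NNReal.toRealHom) (f n))
          (∑ f ∈ (Finset.univ : Finset (Fin N × Fin N → Fin N × Fin N)).filter (fun f => ∀ v, f (f v) = v ∧ f v ≠ v ∧ (((v.1 : ℕ) + 1 = (f v).1 ∧ (v.2 : ℕ) = (f v).2) ∨ (((f v).1 : ℕ) + 1 = v.1 ∧ (v.2 : ℕ) = (f v).2) ∨ ((v.1 : ℕ) = (f v).1 ∧ (v.2 : ℕ) + 1 = (f v).2) ∨ ((v.1 : ℕ) = (f v).1 ∧ ((f v).2 : ℕ) + 1 = v.2))), ∏ v : Fin N × Fin N, (MvPolynomial.X (v, f v) : MvPolynomial ((Fin N × Fin N) × (Fin N × Fin N)) ℂ))) →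
      ∃ c : ℕ, ∀ n, ∃ h : MvPolynomial (σ n) NNReal, h ≠ 0 ∧
        h.totalDegree ≤ 2 ^ ((Nat.log 2 n + c) ^ c) ∧
        complexity (f n * h) + complexity h ≤ 2 ^ ((Nat.log 2 n + c) ^ c)) :
    ∀ (σ : ℕ → Type) [∀ n, Fintype (σ n)] (f : ∀ n, MvPolynomial (σ n) NNReal),
      (∀ n m, MvPolynomial.coeff m (f n) = 0 ∨ MvPolynomial.coeff m (f n) = 1) →
      (∃ c : ℕ, ∀ n : ℕ, ∃ N : ℕ, N ≤ 2 ^ ((Nat.log 2 n + c) ^ c) ∧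
        IsProjection (MvPolynomial.map (Complex.ofRealHom.comp NNReal.toRealHom) (f n))
          (∑ f ∈ (Finset.univ : Finset (Fin N × Fin N → Fin N × Fin N)).filter (fun f => ∀ v, f (f v) = v ∧ f v ≠ v ∧ (((v.1 : ℕ) + 1 = (f v).1 ∧ (v.2 : ℕ) = (f v).2) ∨ (((f v).1 : ℕ) + 1 = v.1 ∧ (v.2 : ℕ) = (f v).2) ∨ ((v.1 : ℕ) = (f v).1 ∧ (v.2 : ℕ) + 1 = (f v).2) ∨ ((v.1 : ℕ) = (f v).1 ∧ ((f v).2 : ℕ) + 1 = v.2))), ∏ v : Fin N × Fin N, (MvPolynomial.X (v, f v) : MvPolynomial ((Fin N × Fin N) × (Fin N × Fin N)) ℂ))) →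
      ∃ c : ℕ, ∀ n : ℕ, ∃ N I J : ℕ, N ≤ 2 ^ ((Nat.log 2 n + c) ^ c) ∧ I ≤ 2 ^ ((Nat.log 2 n + c) ^ c) ∧
        J ≤ 2 ^ ((Nat.log 2 n + c) ^ c) ∧
        ∃ (m : Fin I → MvPolynomial (σ n) NNReal) (g : Fin J → MvPolynomial (σ n) NNReal),
          (∀ i, IsProjection (m i)
            (∑ f ∈ (Finset.univ : Finset (Fin N × Fin N → Fin N × Fin N)).filter (fun f => ∀ v, f (f v) = v ∧ f v ≠ v ∧ (((v.1 : ℕ) + 1 = (f v).1 ∧ (v.2 : ℕ) = (f v).2) ∨ (((f v).1 : ℕ) + 1 = v.1 ∧ (v.2 : ℕ) = (f v).2) ∨ ((v.1 : ℕ) = (f v).1 ∧ (v.2 : ℕ) + 1 = (f v).2) ∨ ((v.1 : ℕ) = (f v).1 ∧ ((f v).2 : ℕ) + 1 = v.2))), ∏ v : Fin N × Fin N, (MvPolynomial.X (v, f v) : MvPolynomial ((Fin N × Fin N) × (Fin N × Fin N)) NNReal))) ∧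
          (∀ j, IsProjection (g j)
            (∑ f ∈ (Finset.univ : Finset (Fin N × Fin N → Fin N × Fin N)).filter (fun f => ∀ v, f (f v) = v ∧ f v ≠ v ∧ (((v.1 : ℕ) + 1 = (f v).1 ∧ (v.2 : ℕ) = (f v).2) ∨ (((f v).1 : ℕ) + 1 = v.1 ∧ (v.2 : ℕ) = (f v).2) ∨ ((v.1 : ℕ) = (f v).1 ∧ (v.2 : ℕ) + 1 = (f v).2) ∨ ((v.1 : ℕ) = (f v).1 ∧ ((f v).2 : ℕ) + 1 = v.2))), ∏ v : Fin N × Fin N, (MvPolynomial.X (v, f v) : MvPolynomial ((Fin N × Fin N) × (Fin N × Fin N)) NNReal))) ∧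
          (∑ i, m i) ≠ 0 ∧ f n * ∑ i, m i = ∑ j, g j :=
  Summit.ValiantsHypothesis.ValiantsHypothesis.Theorems.DivisionGapZeroOneTransfer.signElimination_of_degCertificate H

/-! ## Glue (sorry-free) -/

/-- Bookkeeping: if every `u_i` has cofactor `h_i` within budget `s`, then
`(Σ_i u_i) · Π_i h_i = Σ_i (u_i h_i) · Π_{k ≠ i} h_k` costs `≤ I (s + (I s + I) + 1) + I` and every sub-product
`Π_{i ∈ S} h_i` costs `≤ I s + I` (`complexity_finset_sum_le`, `complexity_finset_prod_le`, `complexity_mul_le`).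
[folklore] -/
theorem sum_prod_bound {τ : Type*} {I : ℕ} (u hu : Fin I → MvPolynomial τ NNReal) (s : ℕ)
    (hle : ∀ i, complexity (u i * hu i) + complexity (hu i) ≤ s) :
    complexity ((∑ i, u i) * ∏ i, hu i) ≤ I * (s + (I * s + I) + 1) + I ∧
      ∀ S : Finset (Fin I), complexity (∏ i ∈ S, hu i) ≤ I * s + I := by
  classical
  have hL_hu : ∀ i, complexity (hu i) ≤ s := fun i => (Nat.le_add_left _ _).trans (hle i)
  have hL_uhu : ∀ i, complexity (u i * hu i) ≤ s := fun i => (Nat.le_add_right _ _).trans (hle i)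
  have hprod : ∀ S : Finset (Fin I), complexity (∏ i ∈ S, hu i) ≤ I * s + I := by
    intro S
    have hS : S.card ≤ I := (Finset.card_le_univ S).trans (by rw [Fintype.card_fin])
    calc complexity (∏ i ∈ S, hu i) ≤ ∑ i ∈ S, complexity (hu i) + S.card :=
          complexity_finset_prod_le S hu
      _ ≤ ∑ i ∈ S, s + S.card := by gcongr with i _; exact hL_hu i
      _ = S.card * s + S.card := by rw [Finset.sum_const, smul_eq_mul]
      _ ≤ I * s + I := by gcongr
  refine ⟨?_, hprod⟩
  have hrw : (∑ i, u i) * ∏ i, hu i = ∑ i, (u i * hu i) * ∏ k ∈ Finset.univ.erase i, hu k := by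
    rw [Finset.sum_mul]
    refine Finset.sum_congr rfl fun i _ => ?_
    rw [← Finset.mul_prod_erase Finset.univ hu (Finset.mem_univ i)]
    ring
  rw [hrw]
  calc complexity (∑ i, (u i * hu i) * ∏ k ∈ Finset.univ.erase i, hu k)
      ≤ ∑ i, complexity ((u i * hu i) * ∏ k ∈ Finset.univ.erase i, hu k) +
          (Finset.univ : Finset (Fin I)).card := complexity_finset_sum_le _ _
    _ ≤ ∑ _i : Fin I, (s + (I * s + I) + 1) + (Finset.univ : Finset (Fin I)).card := by
        gcongr with i _
        have h1 := hL_uhu i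
        have h2 := hprod (Finset.univ.erase i)
        calc complexity ((u i * hu i) * ∏ k ∈ Finset.univ.erase i, hu k)
            ≤ complexity (u i * hu i) + complexity (∏ k ∈ Finset.univ.erase i, hu k) + 1 :=
              complexity_mul_le_holds _ _
          _ ≤ s + (I * s + I) + 1 := by gcongr
    _ = I * (s + (I * s + I) + 1) + I := by
        rw [Finset.sum_const, smul_eq_mul, Finset.card_univ, Fintype.card_fin]

/-- Bookkeeping for a ratio of two short sums: from `f · Σ_i m_i = Σ_j g_j` and cofactors `hm_i`, `hg_j` within
budget `s`, the cofactor `H := (Σ_i m_i) · Π_i hm_i · Π_j hg_j` of `f` satisfies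
`f · H = ((Σ_j g_j) · Π_j hg_j) · Π_i hm_i` and an explicit polynomial bound in `I, J, s`. [folklore] -/
theorem quotient_bound {τ : Type*} {I J : ℕ} (f : MvPolynomial τ NNReal)
    (m hm : Fin I → MvPolynomial τ NNReal) (g hg : Fin J → MvPolynomial τ NNReal) (s : ℕ)
    (hfm : f * ∑ i, m i = ∑ j, g j)
    (hmle : ∀ i, complexity (m i * hm i) + complexity (hm i) ≤ s)
    (hgle : ∀ j, complexity (g j * hg j) + complexity (hg j) ≤ s) :
    complexity (f * ((∑ i, m i) * (∏ i, hm i) * ∏ j, hg j)) +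
        complexity ((∑ i, m i) * (∏ i, hm i) * ∏ j, hg j) ≤
      (J * (s + (J * s + J) + 1) + J + (I * s + I) + 1) +
        (I * (s + (I * s + I) + 1) + I + (J * s + J) + 1) := by
  obtain ⟨hM, hPm⟩ := sum_prod_bound m hm s hmle
  obtain ⟨hG, hPg⟩ := sum_prod_bound g hg s hgle
  have hrw : f * ((∑ i, m i) * (∏ i, hm i) * ∏ j, hg j) = ((∑ j, g j) * ∏ j, hg j) * ∏ i, hm i := by
    rw [← hfm]; ring
  refine add_le_add ?_ ?_
  · rw [hrw]
    have h1 := hPm Finset.univ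
    calc complexity (((∑ j, g j) * ∏ j, hg j) * ∏ i, hm i)
        ≤ complexity ((∑ j, g j) * ∏ j, hg j) + complexity (∏ i, hm i) + 1 := complexity_mul_le_holds _ _
      _ ≤ J * (s + (J * s + J) + 1) + J + (I * s + I) + 1 := by gcongr
  · have h1 := hPg Finset.univ
    calc complexity ((∑ i, m i) * (∏ i, hm i) * ∏ j, hg j)
        ≤ complexity ((∑ i, m i) * ∏ i, hm i) + complexity (∏ j, hg j) + 1 := complexity_mul_le_holds _ _
      _ ≤ I * (s + (I * s + I) + 1) + I + (J * s + J) + 1 := by gcongr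

/-- Arithmetic: with `N, I, J ≤ Q := 2^((ℓ + c)^c)` and budget `s = N^d + d`, the bound of `quotient_bound` is
at most `16 (d+1) Q^(d+2)`. [folklore] -/
theorem arith {N I J d c ℓ : ℕ} (hN : N ≤ 2 ^ ((ℓ + c) ^ c)) (hI : I ≤ 2 ^ ((ℓ + c) ^ c))
    (hJ : J ≤ 2 ^ ((ℓ + c) ^ c)) :
    (J * ((N ^ d + d) + (J * (N ^ d + d) + J) + 1) + J + (I * (N ^ d + d) + I) + 1) +
        (I * ((N ^ d + d) + (I * (N ^ d + d) + I) + 1) + I + (J * (N ^ d + d) + J) + 1) ≤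
      16 * (d + 1) * (2 ^ ((ℓ + c) ^ c)) ^ (d + 2) := by
  set Q : ℕ := 2 ^ ((ℓ + c) ^ c) with hQ
  have hQ1 : 1 ≤ Q := Nat.one_le_two_pow
  have hQd : 1 ≤ Q ^ d := Nat.one_le_pow _ _ hQ1
  set B : ℕ := (d + 1) * Q ^ d with hB
  have hB1 : 1 ≤ B := by
    rw [hB]
    calc (1 : ℕ) = 1 * 1 := rfl
      _ ≤ (d + 1) * Q ^ d := Nat.mul_le_mul (by omega) hQd
  have hs : N ^ d + d ≤ B := by
    calc N ^ d + d ≤ Q ^ d + d * Q ^ d :=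
          add_le_add (Nat.pow_le_pow_left hN d) (Nat.le_mul_of_pos_right d hQd)
      _ = B := by rw [hB]; ring
  have hQpos : 0 < Q := hQ1
  have hBpos : 0 < B := hB1
  have i1 : Q * B ≤ Q * Q * B := by
    rw [mul_assoc]; exact Nat.le_mul_of_pos_left _ hQpos
  have i2 : Q * Q ≤ Q * Q * B := Nat.le_mul_of_pos_right _ hBpos
  have i3 : Q ≤ Q * Q * B := (Nat.le_mul_of_pos_left Q hQpos).trans i2
  have i5 : 1 ≤ Q * Q * B := hQ1.trans i3
  generalize N ^ d + d = s at hs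
  calc (J * (s + (J * s + J) + 1) + J + (I * s + I) + 1) + (I * (s + (I * s + I) + 1) + I + (J * s + J) + 1)
      ≤ (Q * (B + (Q * B + Q) + 1) + Q + (Q * B + Q) + 1) +
          (Q * (B + (Q * B + Q) + 1) + Q + (Q * B + Q) + 1) := by gcongr
    _ = 2 * (Q * Q * B) + 4 * (Q * B) + 2 * (Q * Q) + 6 * Q + 2 := by ring
    _ ≤ 2 * (Q * Q * B) + 4 * (Q * Q * B) + 2 * (Q * Q * B) + 6 * (Q * Q * B) + 2 * (Q * Q * B) := by
        linarith [i1, i2, i3, i5]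
    _ = 16 * (Q * Q * B) := by ring
    _ = 16 * (d + 1) * Q ^ (d + 2) := by rw [hB]; ring

/-- Arithmetic: `16 (d+1) (2^((ℓ + c)^c))^(d+2) ≤ 2^((ℓ + C)^C)` for `C := c + 2d + 6`, uniformly in `ℓ`
(one quasi-polynomial exponent absorbs polynomial post-processing). [folklore] -/
theorem absorb₂ (c d : ℕ) : ∃ C : ℕ, ∀ ℓ : ℕ,
    16 * (d + 1) * (2 ^ ((ℓ + c) ^ c)) ^ (d + 2) ≤ 2 ^ ((ℓ + C) ^ C) := by
  refine ⟨c + 2 * d + 6, fun ℓ => ?_⟩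
  have hE : 1 ≤ (ℓ + c) ^ c := by
    rcases Nat.eq_zero_or_pos c with rfl | hc
    · simp
    · exact Nat.one_le_pow _ _ (by omega)
  have hd : d + 1 ≤ 2 ^ d := Nat.lt_two_pow_self
  have h16 : 16 * (d + 1) ≤ 2 ^ (d + 4) := by
    calc 16 * (d + 1) ≤ 16 * 2 ^ d := Nat.mul_le_mul_left _ hd
      _ = 2 ^ (d + 4) := by rw [pow_add]; ring
  have hexp : d + 4 + (ℓ + c) ^ c * (d + 2) ≤ (ℓ + (c + 2 * d + 6)) ^ (c + 2 * d + 6) := by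
    calc d + 4 + (ℓ + c) ^ c * (d + 2) ≤ (ℓ + c) ^ c * (2 * d + 6) := by nlinarith [hE]
      _ ≤ (ℓ + c + (2 * d + 6)) ^ c * (ℓ + c + (2 * d + 6)) :=
          Nat.mul_le_mul (Nat.pow_le_pow_left (by omega) c) (by omega)
      _ = (ℓ + (c + 2 * d + 6)) ^ (c + 1) := by
          rw [pow_succ, show ℓ + c + (2 * d + 6) = ℓ + (c + 2 * d + 6) by omega]
      _ ≤ (ℓ + (c + 2 * d + 6)) ^ (c + 2 * d + 6) := Nat.pow_le_pow_right (by omega) (by omega)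
  calc 16 * (d + 1) * (2 ^ ((ℓ + c) ^ c)) ^ (d + 2)
      ≤ 2 ^ (d + 4) * (2 ^ ((ℓ + c) ^ c)) ^ (d + 2) := Nat.mul_le_mul_right _ h16
    _ = 2 ^ (d + 4 + (ℓ + c) ^ c * (d + 2)) := by rw [← pow_mul, ← pow_add]
    _ ≤ 2 ^ ((ℓ + (c + 2 * d + 6)) ^ (c + 2 * d + 6)) := Nat.pow_le_pow_right (by norm_num) hexp

/-- Arithmetic: `(2^((ℓ + c₁)^c₁))^c₀ + c₀ ≤ 2^((ℓ + C)^C)` for `C := c₁ + 2c₀ + 1`, uniformly in `ℓ`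
(a polynomial of a quasi-polynomial is quasi-polynomial). [folklore] -/
theorem absorb₁ (c₀ c₁ : ℕ) : ∃ C : ℕ, ∀ ℓ : ℕ,
    (2 ^ ((ℓ + c₁) ^ c₁)) ^ c₀ + c₀ ≤ 2 ^ ((ℓ + C) ^ C) := by
  refine ⟨c₁ + 2 * c₀ + 1, fun ℓ => ?_⟩
  have hE : 1 ≤ (ℓ + c₁) ^ c₁ := by
    rcases Nat.eq_zero_or_pos c₁ with rfl | hc
    · simp
    · exact Nat.one_le_pow _ _ (by omega)
  have hpow : ∀ a b : ℕ, 2 ^ a + b ≤ 2 ^ (a + b) := by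
    intro a b
    have hb : b + 1 ≤ 2 ^ b := Nat.lt_two_pow_self
    have ha : 1 ≤ 2 ^ a := Nat.one_le_two_pow
    calc 2 ^ a + b ≤ 2 ^ a + 2 ^ a * b := by nlinarith
      _ = 2 ^ a * (b + 1) := by ring
      _ ≤ 2 ^ a * 2 ^ b := Nat.mul_le_mul_left _ hb
      _ = 2 ^ (a + b) := by rw [pow_add]
  have hexp : (ℓ + c₁) ^ c₁ * c₀ + c₀ ≤ (ℓ + (c₁ + 2 * c₀ + 1)) ^ (c₁ + 2 * c₀ + 1) := by
    calc (ℓ + c₁) ^ c₁ * c₀ + c₀ ≤ (ℓ + c₁) ^ c₁ * (2 * c₀ + 1) := by nlinarith [hE]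
      _ ≤ (ℓ + c₁ + (2 * c₀ + 1)) ^ c₁ * (ℓ + c₁ + (2 * c₀ + 1)) :=
          Nat.mul_le_mul (Nat.pow_le_pow_left (by omega) c₁) (by omega)
      _ = (ℓ + (c₁ + 2 * c₀ + 1)) ^ (c₁ + 1) := by
          rw [pow_succ, show ℓ + c₁ + (2 * c₀ + 1) = ℓ + (c₁ + 2 * c₀ + 1) by omega]
      _ ≤ (ℓ + (c₁ + 2 * c₀ + 1)) ^ (c₁ + 2 * c₀ + 1) := Nat.pow_le_pow_right (by omega) (by omega)
  calc (2 ^ ((ℓ + c₁) ^ c₁)) ^ c₀ + c₀ = 2 ^ ((ℓ + c₁) ^ c₁ * c₀) + c₀ := by rw [← pow_mul]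
    _ ≤ 2 ^ ((ℓ + c₁) ^ c₁ * c₀ + c₀) := hpow _ _
    _ ≤ 2 ^ ((ℓ + (c₁ + 2 * c₀ + 1)) ^ (c₁ + 2 * c₀ + 1)) := Nat.pow_le_pow_right (by norm_num) hexp

/-- **The composition** (concludes the crux BY NAME; sorry-free given the four stubs).  For a `0/1`-coefficient
family `f` over `ℝ≥0` whose complexification `f'` is in `VP_ℂ`: `VP ⊆ VQP` (`IsVPFamily.isVQPFamily`) and
`VQP_e = VQP` (`BCS1997_thm_21_33_holds`, both PROVED in the tree) bound the formula size `E(f' n)` by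
`2^((log₂ n + c₁)^c₁)`; Stub 1 at `R = ℂ` makes `f' n` a projection of `PM_ℂ(N)`, `N ≤ E^c₀ + c₀`, and `absorb₁`
keeps `N` quasi-polynomial — this is the hypothesis of Stub 2, which returns `f n · Σ_i m_i = Σ_j g_j` with
monotone grid-dimer projections; Stub 3 gives one cofactor `h` for `PM_{ℝ≥0}(N)`; Stub 4 transports it to
cofactors of every `m_i`, `g_j` within the budget `N^d + d`; `quotient_bound` assembles the cofactor
`H = (Σ m_i) · Π hm_i · Π hg_j ≠ 0` of `f n`, and `arith` + `absorb₂` put `L₊(f n · H) + L₊(H)` under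
`2^((log₂ n + C)^C)` with `C` independent of `n`. -/
theorem ZeroOneTransfer_of : ZeroOneTransfer := by
  classical
  intro σ _ f h01 hVP
  -- (U): VP ⊆ VQF (tree) + formulas are projections of grid dimers (Stub 1 at R = ℂ)
  obtain ⟨c₀, hc₀⟩ := stub_formulaGridProjection
  obtain ⟨c₁, hc₁⟩ := (BCS1997_thm_21_33_holds ℂ σ
    (fun n => MvPolynomial.map (Complex.ofRealHom.comp NNReal.toRealHom) (f n)) hVP.1).2
    (IsVPFamily.isVQPFamily hVP).2
  obtain ⟨C₁, hC₁⟩ := absorb₁ c₀ c₁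
  have hU : ∃ c : ℕ, ∀ n : ℕ, ∃ N : ℕ, N ≤ 2 ^ ((Nat.log 2 n + c) ^ c) ∧
      IsProjection (MvPolynomial.map (Complex.ofRealHom.comp NNReal.toRealHom) (f n))
        (∑ f ∈ (Finset.univ : Finset (Fin N × Fin N → Fin N × Fin N)).filter (fun f => ∀ v, f (f v) = v ∧ f v ≠ v ∧ (((v.1 : ℕ) + 1 = (f v).1 ∧ (v.2 : ℕ) = (f v).2) ∨ (((f v).1 : ℕ) + 1 = v.1 ∧ (v.2 : ℕ) = (f v).2) ∨ ((v.1 : ℕ) = (f v).1 ∧ (v.2 : ℕ) + 1 = (f v).2) ∨ ((v.1 : ℕ) = (f v).1 ∧ ((f v).2 : ℕ) + 1 = v.2))), ∏ v : Fin N × Fin N, (MvPolynomial.X (v, f v) : MvPolynomial ((Fin N × Fin N) × (Fin N × Fin N)) ℂ)) := by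
    refine ⟨C₁, fun n => ?_⟩
    obtain ⟨N, hN, hproj⟩ := hc₀ ℂ (σ n) (MvPolynomial.map (Complex.ofRealHom.comp NNReal.toRealHom) (f n))
    refine ⟨N, ?_, hproj⟩
    have hE := hc₁ n
    calc N ≤ (formulaComplexity (MvPolynomial.map (Complex.ofRealHom.comp NNReal.toRealHom) (f n))) ^ c₀ + c₀ := hN
      _ ≤ (2 ^ ((Nat.log 2 n + c₁) ^ c₁)) ^ c₀ + c₀ := by gcongr
      _ ≤ 2 ^ ((Nat.log 2 n + C₁) ^ C₁) := hC₁ (Nat.log 2 n)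
  -- (S): the ratio of two short sums of monotone grid-dimer projections
  obtain ⟨c₂, hc₂⟩ := stub_signElimination σ f h01 hU
  -- (G): one cofactor for the grid dimer polynomial
  obtain ⟨d, hd⟩ := stub_squareGridDimersDivisionEasy
  obtain ⟨C, hC⟩ := absorb₂ c₂ d
  refine ⟨C, fun n => ?_⟩
  obtain ⟨N, I, J, hN, hI, hJ, m, g, hm, hg, hMne, hfm⟩ := hc₂ n
  obtain ⟨h, hne, hle⟩ := hd N
  -- (F1): transport the cofactor to every numerator and denominator summand
  choose hm' hm'ne hm'le using fun i => stub_projectionClosure _ _ (hm i) h hne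
  choose hg' hg'ne hg'le using fun j => stub_projectionClosure _ _ (hg j) h hne
  refine ⟨(∑ i, m i) * (∏ i, hm' i) * ∏ j, hg' j, ?_, ?_⟩
  · exact mul_ne_zero (mul_ne_zero hMne (Finset.prod_ne_zero_iff.mpr fun i _ => hm'ne i))
      (Finset.prod_ne_zero_iff.mpr fun j _ => hg'ne j)
  · calc complexity (f n * ((∑ i, m i) * (∏ i, hm' i) * ∏ j, hg' j)) +
          complexity ((∑ i, m i) * (∏ i, hm' i) * ∏ j, hg' j)
        ≤ (J * ((N ^ d + d) + (J * (N ^ d + d) + J) + 1) + J + (I * (N ^ d + d) + I) + 1) +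
            (I * ((N ^ d + d) + (I * (N ^ d + d) + I) + 1) + I + (J * (N ^ d + d) + J) + 1) :=
          quotient_bound (f n) m hm' g hg' (N ^ d + d) hfm (fun i => (hm'le i).trans hle)
            fun j => (hg'le j).trans hle
      _ ≤ 16 * (d + 1) * (2 ^ ((Nat.log 2 n + c₂) ^ c₂)) ^ (d + 2) := arith hN hI hJ
      _ ≤ 2 ^ ((Nat.log 2 n + C) ^ C) := hC (Nat.log 2 n)

end Summit.ValiantsHypothesis.ValiantsHypothesis.Cruxes.ZeroOneTransfer.PlanarDimerSignElimination
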